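import Summits.QuantumFields.GaugeBoot.TiltedBoxTwoDimGeometry
import HarnessLib

/-!
# The odd square tilted box in two dimensions: blocks of half links and the annulus (gauge-boot, L3 supplement: 2D slab gluing 3/5)

HONEST FRAMING (cell `pub-gaugeboot`, page 1 of every file): the venture produces certified bounds
on lattice expectations at stated coupling, gauge group, dimension and torus size; NOT a mass gap,
NOT a continuum limit, NOT a string tension; NOT Yang–Mills-summit-bearing (barriers
`FixedCouplingUltralocality`, `PerturbativeInvisibility`). Geometric bookkeeping for the POSITIVE
two-dimensional result `TiltedBoxOddAxisRPTwoDim.lean`; it discharges nothing else.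

Continuation of `TiltedBoxTwoDimGeometry.lean` for the ODD square box `ℤ^d/Γ(2P+1, 2P+1, L)`,
`P ≥ 1`, in two dimensions (`∀ k, k = i ∨ k = j`), with the flip `Θ_i : x_i ↦ -x_i` and the closed
half `{0 ≤ x_i ≤ P}` (read through `axisHeight2`, `TiltedBoxOddAxisGeometry.lean`):

* the links of the closed half are the SHARED block `shBlock` (the `j`-links of the pointwise fixed
  layer `x_i ≡ 0`) and the POSITIVE block `posBlock` (`j`-links of the layers `1 … P`, `i`-links based
  in the layers `0 … P-1`) — `isHalfLink_iff_mem_blocks`; `Θ_i` fixes the shared block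
  (`configReflect_apply_of_mem_shBlock`) and reads every positive link off the complement of the
  positive block (`dependsOn_configReflect_apply`) — the hypotheses of the tree's shared-block
  mechanism `LatticeRP.integral_splice_mul_conj_comp_of_shared_nonneg`;
* the slab plaquettes (`IsSlabPlaq`: an `i`-side, base layer `P`) are the `2M = 2(2P+1)` plaquettes
  `(y₀ + t e_j; i, j)` of the ANNULUS between the layers `P` and `P + 1`
  (`filter_isSlabPlaq_eq_image`), its rungs `(y₀ + t e_j, i)` are not half links, its lower links
  `(y₀ + t e_j, j)` are positive, and the twist lemma along the cycle reads
  `Θ_i (y₀ + t e_j) = y₀ + (t + M) e_j + e_i` (`tiltedAxisFlip_cyc`).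

References: J. Fröhlich, R. Israel, E. H. Lieb, B. Simon, J. Stat. Phys. 22 (1980) 297, §3;
K. Osterwalder, E. Seiler, Ann. Phys. 110 (1978) 440, §2.
-/

noncomputable section

open QuotientAddGroup Finset

namespace Summit.QuantumFields.GaugeBoot

namespace TiltedRP

namespace TwoDim

variable {d : ℕ} {i j : Fin d} {L : ℕ}

/-! ## The odd box `M = 2P + 1` in two dimensions: blocks of links -/

section OddBox

variable {P : ℕ} [NeZero L] [NeZero P]

/-- `1 ≤ P`. [folklore] -/
theorem one_le_P : 1 ≤ P := Nat.one_le_iff_ne_zero.2 (NeZero.ne P)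

/-- The SHARED block: the `j`-links of the fixed layer `x_i ≡ 0`. -/
def shBlock (d : ℕ) (i j : Fin d) (L P : ℕ) [NeZero L] :
    Finset (Link (TiltedSite d i j (2 * P + 1) (2 * P + 1) L) d) :=
  Finset.univ.filter fun l => l.2 = j ∧ axisCoord d L (2 * P + 1) l.1 = 0

/-- The POSITIVE block: `j`-links of the layers `1 … P` and `i`-links based in the layers `0 … P-1`. -/
def posBlock (d : ℕ) (i j : Fin d) (L P : ℕ) [NeZero L] :
    Finset (Link (TiltedSite d i j (2 * P + 1) (2 * P + 1) L) d) :=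
  Finset.univ.filter fun l =>
    (l.2 = j ∧ 1 ≤ (axisCoord d L (2 * P + 1) l.1).val ∧ (axisCoord d L (2 * P + 1) l.1).val ≤ P) ∨
    (l.2 = i ∧ (axisCoord d L (2 * P + 1) l.1).val + 1 ≤ P)

omit [NeZero P] in
/-- Membership in the shared block. [folklore] -/
theorem mem_shBlock {l : Link (TiltedSite d i j (2 * P + 1) (2 * P + 1) L) d} :
    l ∈ shBlock d i j L P ↔ l.2 = j ∧ axisCoord d L (2 * P + 1) l.1 = 0 := by
  simp [shBlock]

omit [NeZero P] in
/-- Membership in the positive block. [folklore] -/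
theorem mem_posBlock {l : Link (TiltedSite d i j (2 * P + 1) (2 * P + 1) L) d} :
    l ∈ posBlock d i j L P ↔
      (l.2 = j ∧ 1 ≤ (axisCoord d L (2 * P + 1) l.1).val ∧ (axisCoord d L (2 * P + 1) l.1).val ≤ P) ∨
      (l.2 = i ∧ (axisCoord d L (2 * P + 1) l.1).val + 1 ≤ P) := by
  simp [posBlock]

omit [NeZero P] in
/-- The two blocks are disjoint. [folklore] -/
theorem disjoint_shBlock_posBlock (hij : i ≠ j) : Disjoint (shBlock d i j L P) (posBlock d i j L P) := by
  rw [Finset.disjoint_left]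
  intro l hs hp
  rw [mem_shBlock] at hs
  rw [mem_posBlock] at hp
  rcases hp with ⟨-, h1, -⟩ | ⟨h2, -⟩
  · rw [hs.2, ZMod.val_zero] at h1; omega
  · exact hij (h2.symm.trans hs.1)

omit [NeZero P] in
/-- `val (a + 1) = val a + 1` in `ZMod (2P+1)` below the top. [folklore] -/
theorem val_add_one_of_le {a : ZMod (2 * P + 1)} (ha : a.val ≤ P) (hP : 1 ≤ P) : (a + 1).val = a.val + 1 := by
  have hM1 : 2 * P + 1 ≠ 1 := by omega
  have hlt : a.val + (1 : ZMod (2 * P + 1)).val < 2 * P + 1 := by rw [ZMod.val_one'' hM1]; omega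
  rw [ZMod.val_add_of_lt hlt, ZMod.val_one'' hM1]

/-- **The links of the closed half `{0 ≤ x_i ≤ P}` are the shared and the positive links** (two
dimensions, `P ≥ 1`). [folklore] -/
theorem isHalfLink_iff_mem_blocks (hij : i ≠ j) (hd : ∀ k : Fin d, k = i ∨ k = j)
    (l : Link (TiltedSite d i j (2 * P + 1) (2 * P + 1) L) d) :
    IsHalfLink (tiltedUnit d i j (2 * P + 1) (2 * P + 1) L) (2 * P + 1) (axisHeight2 d L (2 * P + 1)) l ↔
      l ∈ posBlock d i j L P ∨ l ∈ shBlock d i j L P := by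
  have hP : 1 ≤ P := one_le_P
  obtain ⟨x, k⟩ := l
  rw [IsHalfLink, inHalf_iff, inHalf_iff, mem_posBlock, mem_shBlock, axisCoord_add_tiltedUnit]
  simp only
  rcases hd k with rfl | rfl
  · -- an `i`-link
    rw [if_pos rfl]
    simp only [hij, false_and, false_or, true_and, or_false]
    constructor
    · rintro ⟨h1, h2⟩
      rw [val_add_one_of_le h1 hP] at h2
      exact h2
    · intro h
      have h1 : (axisCoord d L (2 * P + 1) x).val ≤ P := by omega
      rw [val_add_one_of_le h1 hP]
      exact ⟨h1, h⟩
  · -- a `j`-link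
    rw [if_neg (Ne.symm hij), add_zero]
    simp only [Ne.symm hij, false_and, or_false, true_and, and_self]
    constructor
    · intro h
      by_cases h0 : axisCoord d L (2 * P + 1) x = 0
      · exact Or.inr h0
      · refine Or.inl ⟨Nat.one_le_iff_ne_zero.2 fun hv => h0 ((ZMod.val_eq_zero _).1 hv), h⟩
    · rintro (⟨-, h⟩ | h)
      · exact h
      · rw [h, ZMod.val_zero]; exact Nat.zero_le _

omit [NeZero P] in
/-- The flip fixes the shared links. [folklore] -/
theorem configReflect_apply_of_mem_shBlock {G : Type*} [Group G] (hij : i ≠ j)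
    (U : Config (TiltedSite d i j (2 * P + 1) (2 * P + 1) L) d G)
    {l : Link (TiltedSite d i j (2 * P + 1) (2 * P + 1) L) d} (hl : l ∈ shBlock d i j L P) :
    configReflect (tiltedUnit d i j (2 * P + 1) (2 * P + 1) L) i (tiltedAxisFlip d L (2 * P + 1) hij) U l = U l := by
  obtain ⟨x, k⟩ := l
  obtain ⟨hk, hx⟩ := mem_shBlock.1 hl
  simp only at hk hx
  subst hk
  rw [configReflect_other _ i _ U x (Ne.symm hij), tiltedAxisFlip_eq_self_of_axisCoord_eq_zero d L _ hij x hx]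

omit [NeZero P] in
/-- `val (-a) = M - val a` for `a ≠ 0` in `ZMod M`, and `0` for `a = 0`. [folklore] -/
theorem val_neg_eq (a : ZMod (2 * P + 1)) : (-a).val = if a = 0 then 0 else 2 * P + 1 - a.val := by
  rw [ZMod.neg_val]

/-- **The flip reads a positive link off the complement of the positive block.** [folklore] -/
theorem siteLinkMap_not_mem_posBlock (hij : i ≠ j) (hd : ∀ k : Fin d, k = i ∨ k = j)
    {l : Link (TiltedSite d i j (2 * P + 1) (2 * P + 1) L) d} (hl : l ∈ posBlock d i j L P) :
    siteLinkMap (tiltedUnit d i j (2 * P + 1) (2 * P + 1) L) i (tiltedAxisFlip d L (2 * P + 1) hij) l ∉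
      posBlock d i j L P := by
  have hP : 1 ≤ P := one_le_P
  obtain ⟨x, k⟩ := l
  intro hmem
  have hval := ZMod.val_lt (axisCoord d L (2 * P + 1) x)
  rcases hd k with hk | hk
  · -- `i`-link: new base `σ x - e_i`, coordinate `-x_i - 1`
    rw [hk] at hl hmem
    rw [siteLinkMap_self, mem_posBlock] at hmem
    rw [mem_posBlock] at hl
    simp only [hij, false_and, false_or, true_and] at hl hmem
    rw [map_sub, axisCoord_tiltedAxisFlip, axisCoord_tiltedUnit_self] at hmem
    have h1 : (-axisCoord d L (2 * P + 1) x - 1 : ZMod (2 * P + 1)) = -(axisCoord d L (2 * P + 1) x + 1) := by ring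
    rw [h1, val_neg_eq] at hmem
    have hne : axisCoord d L (2 * P + 1) x + 1 ≠ 0 := by
      intro h0
      have := congrArg ZMod.val h0
      rw [val_add_one_of_le (by omega) hP, ZMod.val_zero] at this
      omega
    rw [if_neg hne, val_add_one_of_le (by omega) hP] at hmem
    omega
  · -- `j`-link: new base `σ x`, coordinate `-x_i`
    rw [hk] at hl hmem
    rw [siteLinkMap_other _ i _ x (Ne.symm hij), mem_posBlock] at hmem
    rw [mem_posBlock] at hl
    simp only [Ne.symm hij, false_and, or_false, true_and] at hl hmem
    rw [axisCoord_tiltedAxisFlip, val_neg_eq] at hmem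
    by_cases h0 : axisCoord d L (2 * P + 1) x = 0
    · rw [h0, ZMod.val_zero] at hl; omega
    · rw [if_neg h0] at hmem; omega

/-- The reflected value of a positive link depends only on the links off the positive block. [folklore] -/
theorem dependsOn_configReflect_apply {G : Type*} [Group G]
    [DecidableEq (TiltedSite d i j (2 * P + 1) (2 * P + 1) L)] (hij : i ≠ j) (hd : ∀ k : Fin d, k = i ∨ k = j)
    (l : Link (TiltedSite d i j (2 * P + 1) (2 * P + 1) L) d) (hl : l ∈ posBlock d i j L P ∪ ∅) :
    DependsOn (fun U : Config (TiltedSite d i j (2 * P + 1) (2 * P + 1) L) d G =>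
        configReflect (tiltedUnit d i j (2 * P + 1) (2 * P + 1) L) i (tiltedAxisFlip d L (2 * P + 1) hij) U l)
      (((posBlock d i j L P)ᶜ : Finset _) : Set _) := by
  rw [Finset.union_empty] at hl
  intro U V h
  have hmem : siteLinkMap (tiltedUnit d i j (2 * P + 1) (2 * P + 1) L) i (tiltedAxisFlip d L (2 * P + 1) hij) l ∈
      (((posBlock d i j L P)ᶜ : Finset _) : Set _) := by
    rw [Finset.coe_compl, Set.mem_compl_iff, Finset.mem_coe]
    exact siteLinkMap_not_mem_posBlock hij hd hl
  have hUV := h _ hmem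
  show configReflect _ i _ U l = configReflect _ i _ V l
  unfold configReflect
  split_ifs <;> simp [hUV]

/-! ## The annulus: layer `P`, its rungs and plaquettes -/

omit [NeZero L] [NeZero P] in
/-- **The twist lemma along the cycle**: `Θ_i (y₀ + t e_j) = y₀ + (t + M) e_j + e_i` for the base point
`y₀ = [P e_i]` of the layer `P` (`M = 2P + 1`). [folklore] -/
theorem tiltedAxisFlip_cyc (hij : i ≠ j) (t : ℕ) :
    tiltedAxisFlip d L (2 * P + 1) hij (cyc (oddLayerSite d i j L P) t) =
      cyc (oddLayerSite d i j L P) (t + (2 * P + 1)) + tiltedUnit d i j (2 * P + 1) (2 * P + 1) L i := by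
  rw [tiltedAxisFlip_of_axisCoord_eq d L P hij _ (by rw [axisCoord_cyc hij, axisCoord_oddLayerSite]),
    add_right_comm, cyc_add_tiltedTwist]

omit [NeZero L] in
/-- A rung `(y₀ + t e_j, i)` of the annulus is not a link of the closed half. [folklore] -/
theorem rung_not_isHalfLink (hij : i ≠ j) (t : ℕ) :
    ¬ IsHalfLink (tiltedUnit d i j (2 * P + 1) (2 * P + 1) L) (2 * P + 1) (axisHeight2 d L (2 * P + 1))
      (cyc (oddLayerSite d i j L P) t, i) := by
  rintro ⟨-, h2⟩
  rw [inHalf_iff, axisCoord_add_tiltedUnit, if_pos rfl, axisCoord_cyc hij, axisCoord_oddLayerSite] at h2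
  have hP : 1 ≤ P := one_le_P
  have hv : (((P : ℕ) : ZMod (2 * P + 1)) + 1).val = P + 1 := by
    rw [val_add_one_of_le (by rw [ZMod.val_natCast]; exact (Nat.mod_le _ _)) hP,
      ZMod.val_natCast, Nat.mod_eq_of_lt (by omega)]
  rw [hv] at h2
  omega

/-- A rung is neither shared nor positive. [folklore] -/
theorem rung_not_mem_blocks [DecidableEq (TiltedSite d i j (2 * P + 1) (2 * P + 1) L)] (hij : i ≠ j)
    (hd : ∀ k : Fin d, k = i ∨ k = j) (t : ℕ) :
    (cyc (oddLayerSite d i j L P) t, i) ∉ posBlock d i j L P ∪ ∅ ∪ shBlock d i j L P := by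
  rw [Finset.union_empty, Finset.mem_union, ← isHalfLink_iff_mem_blocks hij hd]
  exact rung_not_isHalfLink hij t

/-- The `j`-link `(y₀ + t e_j, j)` of the layer `P` is a positive link (`P ≥ 1`). [folklore] -/
theorem aLink_mem_posBlock (hij : i ≠ j) (t : ℕ) :
    (cyc (oddLayerSite d i j L P) t, j) ∈ posBlock d i j L P := by
  have hP : 1 ≤ P := one_le_P
  have hv : (axisCoord d L (2 * P + 1) (cyc (oddLayerSite d i j L P) t)).val = P := by
    rw [axisCoord_cyc hij, axisCoord_oddLayerSite, ZMod.val_natCast, Nat.mod_eq_of_lt (by omega)]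
  rw [mem_posBlock, hv]
  exact Or.inl ⟨rfl, hP, le_rfl⟩

omit [NeZero P] in
/-- **The slab plaquettes are the `2M` plaquettes of the annulus.** [folklore] -/
theorem filter_isSlabPlaq_eq_image [DecidableEq (TiltedSite d i j (2 * P + 1) (2 * P + 1) L)] (hij : i ≠ j)
    (hd : ∀ k : Fin d, k = i ∨ k = j) :
    Finset.univ.filter (IsSlabPlaq (P := P) (L := L)) =
      (Finset.range (2 * (2 * P + 1))).image fun t => (cyc (oddLayerSite d i j L P) t, dp hij) := by
  ext p
  obtain ⟨x, q⟩ := p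
  simp only [Finset.mem_filter, Finset.mem_univ, true_and, Finset.mem_image, Finset.mem_range, IsSlabPlaq,
    Prod.mk.injEq]
  constructor
  · rintro ⟨-, hx⟩
    obtain ⟨t, ht, rfl⟩ := exists_eq_cyc_of_axisCoord_eq hij hd (y := oddLayerSite d i j L P)
      (by rw [hx, axisCoord_oddLayerSite])
    exact ⟨t, ht, rfl, (dirPair_eq_dp hij hd q).symm⟩
  · rintro ⟨t, -, rfl, rfl⟩
    exact ⟨mkDirPair_hasDir i j (Ne.symm hij), by rw [axisCoord_cyc hij, axisCoord_oddLayerSite]⟩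

omit [NeZero L] [NeZero P] in
/-- The annulus parametrisation is injective on `[0, 2M)`. [folklore] -/
theorem annulus_injOn (hij : i ≠ j) :
    Set.InjOn (fun t => (cyc (oddLayerSite d i j L P) t, dp hij)) (Finset.range (2 * (2 * P + 1)) : Set ℕ) := by
  intro s hs t ht h
  simp only [Finset.coe_range, Set.mem_Iio, Prod.mk.injEq] at hs ht h
  exact cyc_inj hij _ hs ht h.1

end OddBox

end TwoDim

end TiltedRP

end Summit.QuantumFields.GaugeBoot

end
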